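import Mathlib
import HarnessLib
import Summits.HubbardSuperconductivity.HubbardSuperconductivity.Theorems.KLProgrammePerturbedFermiCurveWindowJetsSharp

/-!
# Route `KLProgramme` — the frame's radius widths `W₃, W₄` on a level window in SHARP form (orders 3, 4 of `…WindowJetsSharp`)

Cell `gate-hubbard-kl`, seat hubbard-kl-k3c3-p3 (g7; row «implicit-function / monotonicity route for μ(n)»); engine-flow child `KLRegimeEngineV17F2`
(stmt-HubbardSuperconductivity-20437), stub (C); k3c3-p1 g7's (C1) certificate quantifies over a 4-jet box of the displaced curve around the free curve
(KL STATUS l.3374: tight box `δ = (0.002, 0.05, 2, 50, 2000)`), whose widths for an admissible frame are these `W_k`.  As in `…WindowJetsSharp`, the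
`…TwoFrameTower3/4` lemmas are fed DIRECTLY with the window's sharp `U₀, R₁, R₂, R₃` (not `π√2` and the uniform bounds) and the free side's exact sizes
`‖Dᵏε₀‖ ≤ 4` (`κ_k = 0`), the frame entering only through `Δ₁ = 4W₀+2A₁`, `Δ₂ = 4W₀+4A₂`, `Δ₃ = 4W₀+8A₃`, `Δ₄ = 4W₀+16A₄` and the lower widths:

* `abs_deriv_three_frameRadius_sub_le_sharp`, `abs_deriv_four_frameRadius_sub_le_sharp` (closed forms LINEAR in `(A₃, A₄)` given the lower widths);
* `frame_polar_tower_of_window_sharp34`: the order-3/4 package on top of `frame_polar_tower_of_window_sharp`.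

Everything is PROVED; no definitions.  References: BGM 2006 §2.4 Lemma 2.1 (2.40) [cite: BenfattoGiulianiMastropietro2006].
-/

noncomputable section

namespace Summit.HubbardSuperconductivity.HubbardSuperconductivity.Theorems.PerturbedFermiCurve

set_option linter.dupNamespace false -- summit = problem name (single-conjunct summit), D-0017
set_option maxSynthPendingDepth 4 -- nested operator-norm instances (fourth Fréchet derivatives)

open Real Set
open Literature.MathematicalPhysics.QuantumLattice Literature.MathematicalPhysics.QuantumLattice.BandSectorCounting
open Summit.HubbardSuperconductivity.HubbardSuperconductivity.Theorems.DispersionFlow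
open Summit.HubbardSuperconductivity.HubbardSuperconductivity.Theorems.KLRegimeSplit

section Frame

variable {a b : ℝ} (B : BandBounds a b) {K : TrigPolyC4v} {A₀ A₁ A₂ A₃ A₄ : ℝ}
  (hA₀ : ∀ p : Momentum, ‖iteratedFDeriv ℝ 0 (frameShift K) p‖ ≤ A₀)
  (hA₁ : ∀ p : Momentum, ‖iteratedFDeriv ℝ 1 (frameShift K) p‖ ≤ A₁)
  (hA₂ : ∀ p : Momentum, ‖iteratedFDeriv ℝ 2 (frameShift K) p‖ ≤ A₂)
  (hA₃ : ∀ p : Momentum, ‖iteratedFDeriv ℝ 3 (frameShift K) p‖ ≤ A₃)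
  (hA₄ : ∀ p : Momentum, ‖iteratedFDeriv ℝ 4 (frameShift K) p‖ ≤ A₄)
  (hA₁Dt : 2 * A₁ < B.Dtmin) {ν : ℝ} (hlo : a ≤ ν - A₀) (hhi : ν + A₀ ≤ b)

include B hA₀ hA₁ hA₂ hA₃ hA₁Dt hlo hhi in
/-- **Order 3, SHARP**: free sizes `u ≤ U₀`, `|u′| ≤ R₁`, `|u″| ≤ R₂`, `|u‴| ≤ R₃` at `θ`, lower widths `W₁, W₂`; `W₀ = A₀/(Dt_min − 2A₁)`: the bound of
`abs_deriv_three_sub_le_of_polar_levels` at `E_k = 4`, `Δ = (4W₀+2A₁, 4W₀+4A₂, 4W₀+8A₃)`, sizes `U₀+W₀`, `R₁+W₁`, `R₂+W₂` — linear in `A₃`.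
[cite: BenfattoGiulianiMastropietro2006, §2.4 Lemma 2.1 (2.40)] -/
theorem abs_deriv_three_frameRadius_sub_le_sharp {θ U₀ R₁ R₂ R₃ W₁ W₂ : ℝ} (hU₀ : bandFermiRadius ν θ ≤ U₀)
    (hR₁ : |deriv (bandFermiRadius ν) θ| ≤ R₁) (hR₂ : |deriv (deriv (bandFermiRadius ν)) θ| ≤ R₂)
    (hR₃ : |deriv (deriv (deriv (bandFermiRadius ν))) θ| ≤ R₃)
    (hW₁ : |deriv (perturbedFermiRadius (fun p : Fin 2 → ℝ => -K.eval p) ν) θ - deriv (bandFermiRadius ν) θ| ≤ W₁)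
    (hW₂ : |deriv (deriv (perturbedFermiRadius (fun p : Fin 2 → ℝ => -K.eval p) ν)) θ - deriv (deriv (bandFermiRadius ν)) θ| ≤ W₂) :
    |deriv (deriv (deriv (perturbedFermiRadius (fun p : Fin 2 → ℝ => -K.eval p) ν))) θ - deriv (deriv (deriv (bandFermiRadius ν))) θ| ≤
      ((4 * (A₀ / (B.Dtmin - 2 * A₁)) + 8 * A₃) * ((R₁ + W₁) + (U₀ + (A₀ / (B.Dtmin - 2 * A₁)))) ^ 3 + 3 * 4 * (W₁ + (A₀ / (B.Dtmin - 2 * A₁))) * ((R₁ + W₁) + (U₀ + (A₀ / (B.Dtmin - 2 * A₁)))) ^ 2 +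
        3 * ((4 * (A₀ / (B.Dtmin - 2 * A₁)) + 4 * A₂) * ((R₁ + W₁) + (U₀ + (A₀ / (B.Dtmin - 2 * A₁)))) * ((R₂ + W₂) + 2 * (R₁ + W₁) + (U₀ + (A₀ / (B.Dtmin - 2 * A₁)))) + 4 * ((W₂ + 2 * W₁ + (A₀ / (B.Dtmin - 2 * A₁))) * ((R₁ + W₁) + (U₀ + (A₀ / (B.Dtmin - 2 * A₁)))) + ((R₂ + W₂) + 2 * (R₁ + W₁) + (U₀ + (A₀ / (B.Dtmin - 2 * A₁)))) * (W₁ + (A₀ / (B.Dtmin - 2 * A₁))))) +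
        (4 * (A₀ / (B.Dtmin - 2 * A₁)) + 2 * A₁) * (3 * (R₂ + W₂) + 3 * (R₁ + W₁) + (U₀ + (A₀ / (B.Dtmin - 2 * A₁)))) + 4 * (3 * W₂ + 3 * W₁ + (A₀ / (B.Dtmin - 2 * A₁))) + R₃ * (4 * (A₀ / (B.Dtmin - 2 * A₁)) + 2 * A₁)) / (B.Dtmin - 2 * A₁) := by
  have hA0 : 0 ≤ A₀ := le_trans (norm_nonneg _) (hA₀ 0)
  have hδs : ContDiff ℝ 4 (0 : (Fin 2 → ℝ) → ℝ) := contDiff_const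
  have hδs' : ContDiff ℝ 4 (fun p : Fin 2 → ℝ => -K.eval p) := contDiff_four_negEval
  have hδ : ∀ k : Fin 2 → ℝ, (∀ i, |k i| ≤ π) → |(0 : (Fin 2 → ℝ) → ℝ) k| ≤ A₀ := fun k _ => by simpa using hA0
  have hδ' : ∀ k : Fin 2 → ℝ, (∀ i, |k i| ≤ π) → |(fun p : Fin 2 → ℝ => -K.eval p) k| ≤ A₀ := fun k _ => abs_negEval_le hA₀ k
  have hκ : ∀ k : Fin 2 → ℝ, (∀ i, |k i| ≤ π) → ‖fderiv ℝ (0 : (Fin 2 → ℝ) → ℝ) k‖ ≤ 2 * A₁ := fun k _ => by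
    simp; exact le_trans (norm_nonneg _) (hA₁ 0)
  have hκ' : ∀ k : Fin 2 → ℝ, (∀ i, |k i| ≤ π) → ‖fderiv ℝ (fun p : Fin 2 → ℝ => -K.eval p) k‖ ≤ 2 * A₁ :=
    fun k _ => norm_fderiv_negEval_le hA₁ k
  have hκ0 : ∀ k : Fin 2 → ℝ, (∀ i, |k i| ≤ π) → ‖fderiv ℝ (0 : (Fin 2 → ℝ) → ℝ) k‖ ≤ 0 := fun k _ => by simp
  have hu := isBandFermiRadius_free B hA₀ hlo hhi
  have hv := isBandFermiRadius_frameRadius_perOrder B hA₀ hlo hhi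
  have hE₀ : ∀ k : Fin 2 → ℝ, (∀ i, |k i| ≤ π) → |(fun p : Fin 2 → ℝ => -K.eval p) k - (0 : (Fin 2 → ℝ) → ℝ) k| ≤ A₀ :=
    fun k _ => by simpa using abs_negEval_le hA₀ k
  obtain ⟨h4, h0⟩ := level_mem_band B hA₀ hlo hhi
  have hρ0 : 0 < B.Dtmin - 2 * A₁ := sub_pos.2 hA₁Dt
  have hW₀ := abs_frameRadius_sub_bandFermiRadius_le B hA₀ hA₁ hA₁Dt hlo hhi θ
  have hW0nn : 0 ≤ A₀ / (B.Dtmin - 2 * A₁) := div_nonneg hA0 hρ0.le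
  have hUf : |bandFermiRadius ν θ| ≤ U₀ := by rw [abs_of_pos (bandFermiRadius_pos h4 h0 θ)]; exact hU₀
  have hUf' : |bandFermiRadius ν θ| ≤ U₀ + A₀ / (B.Dtmin - 2 * A₁) := hUf.trans (le_add_of_nonneg_right hW0nn)
  have hUv : |perturbedFermiRadius (fun p : Fin 2 → ℝ => -K.eval p) ν θ| ≤ U₀ + A₀ / (B.Dtmin - 2 * A₁) :=
    abs_le_add_of_abs_sub_le hUf hW₀
  have hR₁f : |deriv (bandFermiRadius ν) θ| ≤ R₁ + W₁ := hR₁.trans (le_add_of_nonneg_right ((abs_nonneg _).trans hW₁))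
  have hR₁v := abs_le_add_of_abs_sub_le hR₁ hW₁
  have hR₂f : |deriv (deriv (bandFermiRadius ν)) θ| ≤ R₂ + W₂ := hR₂.trans (le_add_of_nonneg_right ((abs_nonneg _).trans hW₂))
  have hR₂v := abs_le_add_of_abs_sub_le hR₂ hW₂
  have he : ContDiff ℝ 4 (fun k : Fin 2 → ℝ => sqDispersion k + (0 : (Fin 2 → ℝ) → ℝ) k) := contDiff_pertBand hδs
  have he' : ContDiff ℝ 4 (fun k : Fin 2 → ℝ => sqDispersion k + (fun p : Fin 2 → ℝ => -K.eval p) k) := contDiff_pertBand hδs'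
  have hlev : ∀ ϑ, (fun k : Fin 2 → ℝ => sqDispersion k + (0 : (Fin 2 → ℝ) → ℝ) k) (bandFermiRadius ν ϑ • dir ϑ) = ν :=
    pertBand_level (δ := (0 : (Fin 2 → ℝ) → ℝ)) (μ := ν) hu
  have hlev' : ∀ ϑ, (fun k : Fin 2 → ℝ => sqDispersion k + (fun p : Fin 2 → ℝ => -K.eval p) k)
      (perturbedFermiRadius (fun p : Fin 2 → ℝ => -K.eval p) ν ϑ • dir ϑ) = ν :=
    pertBand_level (δ := fun p : Fin 2 → ℝ => -K.eval p) (μ := ν) hv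
  have hE₁ : ‖fderiv ℝ (fun k : Fin 2 → ℝ => sqDispersion k + (0 : (Fin 2 → ℝ) → ℝ) k) (bandFermiRadius ν θ • dir θ)‖ ≤ 4 := by
    simpa using norm_fderiv_pertBand_le hδs hκ0 hu θ
  have hE₂ : ‖fderiv ℝ (fderiv ℝ (fun k : Fin 2 → ℝ => sqDispersion k + (0 : (Fin 2 → ℝ) → ℝ) k)) (bandFermiRadius ν θ • dir θ)‖ ≤ 4 := by
    simpa using norm_fderiv_two_pertBand_le hδs hu (κ₂ := 0) (fun k _ => by simp) θ
  have hE₃ : ‖fderiv ℝ (fderiv ℝ (fderiv ℝ (fun k : Fin 2 → ℝ => sqDispersion k + (0 : (Fin 2 → ℝ) → ℝ) k)))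
      (bandFermiRadius ν θ • dir θ)‖ ≤ 4 := by
    simpa using norm_fderiv_three_pertBand_le hδs hu (κ₃ := 0) (fun k _ => by simp) θ
  have hΔ₁ : ‖fderiv ℝ (fun k : Fin 2 → ℝ => sqDispersion k + (fun p : Fin 2 → ℝ => -K.eval p) k)
        (perturbedFermiRadius (fun p : Fin 2 → ℝ => -K.eval p) ν θ • dir θ) -
      fderiv ℝ (fun k : Fin 2 → ℝ => sqDispersion k + (0 : (Fin 2 → ℝ) → ℝ) k) (bandFermiRadius ν θ • dir θ)‖ ≤
      4 * (A₀ / (B.Dtmin - 2 * A₁)) + 2 * A₁ :=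
    (norm_fderiv_two_roots_sub_le B hδs hδs' hδ hδ' hlo hhi hκ hA₁Dt hu hv hE₀ (κ₂ := 0) (E₁ := 2 * A₁) (fun k _ => by simp)
      (fun k _ => by simpa using norm_fderiv_negEval_le hA₁ k) θ).trans (le_of_eq (by ring))
  have hΔ₂ : ‖fderiv ℝ (fderiv ℝ (fun k : Fin 2 → ℝ => sqDispersion k + (fun p : Fin 2 → ℝ => -K.eval p) k))
        (perturbedFermiRadius (fun p : Fin 2 → ℝ => -K.eval p) ν θ • dir θ) -
      fderiv ℝ (fderiv ℝ (fun k : Fin 2 → ℝ => sqDispersion k + (0 : (Fin 2 → ℝ) → ℝ) k)) (bandFermiRadius ν θ • dir θ)‖ ≤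
      4 * (A₀ / (B.Dtmin - 2 * A₁)) + 4 * A₂ :=
    (norm_fderiv_two_two_roots_sub_le B hδs hδs' hδ hδ' hlo hhi hκ hA₁Dt hu hv hE₀ (κ₃ := 0) (E₂ := 4 * A₂) (fun k _ => by simp)
      (fun k _ => by simpa using norm_fderiv_two_negEval_le hA₂ k) θ).trans (le_of_eq (by ring))
  have hΔ₃ : ‖fderiv ℝ (fderiv ℝ (fderiv ℝ (fun k : Fin 2 → ℝ => sqDispersion k + (fun p : Fin 2 → ℝ => -K.eval p) k)))
        (perturbedFermiRadius (fun p : Fin 2 → ℝ => -K.eval p) ν θ • dir θ) -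
      fderiv ℝ (fderiv ℝ (fderiv ℝ (fun k : Fin 2 → ℝ => sqDispersion k + (0 : (Fin 2 → ℝ) → ℝ) k))) (bandFermiRadius ν θ • dir θ)‖ ≤
      4 * (A₀ / (B.Dtmin - 2 * A₁)) + 8 * A₃ :=
    (norm_fderiv_three_two_roots_sub_le B hδs hδs' hδ hδ' hlo hhi hκ hA₁Dt hu hv hE₀ (κ₄ := 0) (E₃ := 8 * A₃) (fun k _ => by simp)
      (fun k _ => by simpa using norm_fderiv_three_frameShift_le hA₃ k) θ).trans (le_of_eq (by ring))
  exact abs_deriv_three_sub_le_of_polar_levels he he'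
    (contDiff_four_of_isRoot B hδs hδ hlo hhi hκ hA₁Dt hu) (contDiff_four_of_isRoot B hδs' hδ' hlo hhi hκ' hA₁Dt hv)
    hlev hlev' hρ0 (Dtmin_sub_le_fderiv_pertBand_dir B hδ' hlo hhi hκ' hv hδs' θ) hE₁ hE₂ hE₃ hΔ₁ hΔ₂ hΔ₃
    hUf' hUv hR₁f hR₁v hR₂f hR₂v hR₃ hW₀ hW₁ hW₂

include B hA₀ hA₁ hA₂ hA₃ hA₄ hA₁Dt hlo hhi in
/-- **Order 4, SHARP**: as above with `|u⁗| ≤ R₄`, lower widths `W₁, W₂, W₃`, `Δ₄ = 4W₀+16A₄`, size `R₃+W₃` — linear in `(A₃, A₄)`.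
[cite: BenfattoGiulianiMastropietro2006, §2.4 Lemma 2.1 (2.40)] -/
theorem abs_deriv_four_frameRadius_sub_le_sharp {θ U₀ R₁ R₂ R₃ R₄ W₁ W₂ W₃ : ℝ} (hU₀ : bandFermiRadius ν θ ≤ U₀)
    (hR₁ : |deriv (bandFermiRadius ν) θ| ≤ R₁) (hR₂ : |deriv (deriv (bandFermiRadius ν)) θ| ≤ R₂)
    (hR₃ : |deriv (deriv (deriv (bandFermiRadius ν))) θ| ≤ R₃) (hR₄ : |deriv (deriv (deriv (deriv (bandFermiRadius ν)))) θ| ≤ R₄)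
    (hW₁ : |deriv (perturbedFermiRadius (fun p : Fin 2 → ℝ => -K.eval p) ν) θ - deriv (bandFermiRadius ν) θ| ≤ W₁)
    (hW₂ : |deriv (deriv (perturbedFermiRadius (fun p : Fin 2 → ℝ => -K.eval p) ν)) θ - deriv (deriv (bandFermiRadius ν)) θ| ≤ W₂)
    (hW₃ : |deriv (deriv (deriv (perturbedFermiRadius (fun p : Fin 2 → ℝ => -K.eval p) ν))) θ -
      deriv (deriv (deriv (bandFermiRadius ν))) θ| ≤ W₃) :
    |deriv (deriv (deriv (deriv (perturbedFermiRadius (fun p : Fin 2 → ℝ => -K.eval p) ν)))) θ -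
        deriv (deriv (deriv (deriv (bandFermiRadius ν)))) θ| ≤
      ((4 * (A₀ / (B.Dtmin - 2 * A₁)) + 16 * A₄) * ((R₁ + W₁) + (U₀ + (A₀ / (B.Dtmin - 2 * A₁)))) ^ 4 + 4 * 4 * (W₁ + (A₀ / (B.Dtmin - 2 * A₁))) * ((R₁ + W₁) + (U₀ + (A₀ / (B.Dtmin - 2 * A₁)))) ^ 3 +
        6 * ((4 * (A₀ / (B.Dtmin - 2 * A₁)) + 8 * A₃) * ((R₁ + W₁) + (U₀ + (A₀ / (B.Dtmin - 2 * A₁)))) ^ 2 * ((R₂ + W₂) + 2 * (R₁ + W₁) + (U₀ + (A₀ / (B.Dtmin - 2 * A₁)))) +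
          4 * ((W₂ + 2 * W₁ + (A₀ / (B.Dtmin - 2 * A₁))) * ((R₁ + W₁) + (U₀ + (A₀ / (B.Dtmin - 2 * A₁)))) ^ 2 + 2 * ((R₁ + W₁) + (U₀ + (A₀ / (B.Dtmin - 2 * A₁)))) * ((R₂ + W₂) + 2 * (R₁ + W₁) + (U₀ + (A₀ / (B.Dtmin - 2 * A₁)))) * (W₁ + (A₀ / (B.Dtmin - 2 * A₁))))) +
        3 * ((4 * (A₀ / (B.Dtmin - 2 * A₁)) + 4 * A₂) * ((R₂ + W₂) + 2 * (R₁ + W₁) + (U₀ + (A₀ / (B.Dtmin - 2 * A₁)))) ^ 2 + 2 * 4 * ((R₂ + W₂) + 2 * (R₁ + W₁) + (U₀ + (A₀ / (B.Dtmin - 2 * A₁)))) * (W₂ + 2 * W₁ + (A₀ / (B.Dtmin - 2 * A₁)))) +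
        4 * ((4 * (A₀ / (B.Dtmin - 2 * A₁)) + 4 * A₂) * ((R₁ + W₁) + (U₀ + (A₀ / (B.Dtmin - 2 * A₁)))) * ((R₃ + W₃) + 3 * (R₁ + W₁) + 3 * (R₂ + W₂) + (U₀ + (A₀ / (B.Dtmin - 2 * A₁)))) +
          4 * ((W₁ + (A₀ / (B.Dtmin - 2 * A₁))) * ((R₃ + W₃) + 3 * (R₁ + W₁) + 3 * (R₂ + W₂) + (U₀ + (A₀ / (B.Dtmin - 2 * A₁)))) + ((R₁ + W₁) + (U₀ + (A₀ / (B.Dtmin - 2 * A₁)))) * (W₃ + 3 * W₁ + 3 * W₂ + (A₀ / (B.Dtmin - 2 * A₁))))) +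
        (4 * (A₀ / (B.Dtmin - 2 * A₁)) + 2 * A₁) * (6 * (R₂ + W₂) + 4 * (R₃ + W₃) + 4 * (R₁ + W₁) + (U₀ + (A₀ / (B.Dtmin - 2 * A₁)))) + 4 * (6 * W₂ + 4 * W₃ + 4 * W₁ + (A₀ / (B.Dtmin - 2 * A₁))) + R₄ * (4 * (A₀ / (B.Dtmin - 2 * A₁)) + 2 * A₁)) / (B.Dtmin - 2 * A₁) := by
  have hA0 : 0 ≤ A₀ := le_trans (norm_nonneg _) (hA₀ 0)
  have hδs : ContDiff ℝ 4 (0 : (Fin 2 → ℝ) → ℝ) := contDiff_const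
  have hδs' : ContDiff ℝ 4 (fun p : Fin 2 → ℝ => -K.eval p) := contDiff_four_negEval
  have hδ : ∀ k : Fin 2 → ℝ, (∀ i, |k i| ≤ π) → |(0 : (Fin 2 → ℝ) → ℝ) k| ≤ A₀ := fun k _ => by simpa using hA0
  have hδ' : ∀ k : Fin 2 → ℝ, (∀ i, |k i| ≤ π) → |(fun p : Fin 2 → ℝ => -K.eval p) k| ≤ A₀ := fun k _ => abs_negEval_le hA₀ k
  have hκ : ∀ k : Fin 2 → ℝ, (∀ i, |k i| ≤ π) → ‖fderiv ℝ (0 : (Fin 2 → ℝ) → ℝ) k‖ ≤ 2 * A₁ := fun k _ => by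
    simp; exact le_trans (norm_nonneg _) (hA₁ 0)
  have hκ' : ∀ k : Fin 2 → ℝ, (∀ i, |k i| ≤ π) → ‖fderiv ℝ (fun p : Fin 2 → ℝ => -K.eval p) k‖ ≤ 2 * A₁ :=
    fun k _ => norm_fderiv_negEval_le hA₁ k
  have hκ0 : ∀ k : Fin 2 → ℝ, (∀ i, |k i| ≤ π) → ‖fderiv ℝ (0 : (Fin 2 → ℝ) → ℝ) k‖ ≤ 0 := fun k _ => by simp
  have hu := isBandFermiRadius_free B hA₀ hlo hhi
  have hv := isBandFermiRadius_frameRadius_perOrder B hA₀ hlo hhi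
  have hE₀ : ∀ k : Fin 2 → ℝ, (∀ i, |k i| ≤ π) → |(fun p : Fin 2 → ℝ => -K.eval p) k - (0 : (Fin 2 → ℝ) → ℝ) k| ≤ A₀ :=
    fun k _ => by simpa using abs_negEval_le hA₀ k
  obtain ⟨h4, h0⟩ := level_mem_band B hA₀ hlo hhi
  have hρ0 : 0 < B.Dtmin - 2 * A₁ := sub_pos.2 hA₁Dt
  have hW₀ := abs_frameRadius_sub_bandFermiRadius_le B hA₀ hA₁ hA₁Dt hlo hhi θ
  have hW0nn : 0 ≤ A₀ / (B.Dtmin - 2 * A₁) := div_nonneg hA0 hρ0.le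
  have hUf : |bandFermiRadius ν θ| ≤ U₀ := by rw [abs_of_pos (bandFermiRadius_pos h4 h0 θ)]; exact hU₀
  have hUf' : |bandFermiRadius ν θ| ≤ U₀ + A₀ / (B.Dtmin - 2 * A₁) := hUf.trans (le_add_of_nonneg_right hW0nn)
  have hUv : |perturbedFermiRadius (fun p : Fin 2 → ℝ => -K.eval p) ν θ| ≤ U₀ + A₀ / (B.Dtmin - 2 * A₁) :=
    abs_le_add_of_abs_sub_le hUf hW₀
  have hR₁f : |deriv (bandFermiRadius ν) θ| ≤ R₁ + W₁ := hR₁.trans (le_add_of_nonneg_right ((abs_nonneg _).trans hW₁))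
  have hR₁v := abs_le_add_of_abs_sub_le hR₁ hW₁
  have hR₂f : |deriv (deriv (bandFermiRadius ν)) θ| ≤ R₂ + W₂ := hR₂.trans (le_add_of_nonneg_right ((abs_nonneg _).trans hW₂))
  have hR₂v := abs_le_add_of_abs_sub_le hR₂ hW₂
  have he : ContDiff ℝ 4 (fun k : Fin 2 → ℝ => sqDispersion k + (0 : (Fin 2 → ℝ) → ℝ) k) := contDiff_pertBand hδs
  have he' : ContDiff ℝ 4 (fun k : Fin 2 → ℝ => sqDispersion k + (fun p : Fin 2 → ℝ => -K.eval p) k) := contDiff_pertBand hδs'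
  have hlev : ∀ ϑ, (fun k : Fin 2 → ℝ => sqDispersion k + (0 : (Fin 2 → ℝ) → ℝ) k) (bandFermiRadius ν ϑ • dir ϑ) = ν :=
    pertBand_level (δ := (0 : (Fin 2 → ℝ) → ℝ)) (μ := ν) hu
  have hlev' : ∀ ϑ, (fun k : Fin 2 → ℝ => sqDispersion k + (fun p : Fin 2 → ℝ => -K.eval p) k)
      (perturbedFermiRadius (fun p : Fin 2 → ℝ => -K.eval p) ν ϑ • dir ϑ) = ν :=
    pertBand_level (δ := fun p : Fin 2 → ℝ => -K.eval p) (μ := ν) hv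
  have hE₁ : ‖fderiv ℝ (fun k : Fin 2 → ℝ => sqDispersion k + (0 : (Fin 2 → ℝ) → ℝ) k) (bandFermiRadius ν θ • dir θ)‖ ≤ 4 := by
    simpa using norm_fderiv_pertBand_le hδs hκ0 hu θ
  have hE₂ : ‖fderiv ℝ (fderiv ℝ (fun k : Fin 2 → ℝ => sqDispersion k + (0 : (Fin 2 → ℝ) → ℝ) k)) (bandFermiRadius ν θ • dir θ)‖ ≤ 4 := by
    simpa using norm_fderiv_two_pertBand_le hδs hu (κ₂ := 0) (fun k _ => by simp) θ
  have hE₃ : ‖fderiv ℝ (fderiv ℝ (fderiv ℝ (fun k : Fin 2 → ℝ => sqDispersion k + (0 : (Fin 2 → ℝ) → ℝ) k)))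
      (bandFermiRadius ν θ • dir θ)‖ ≤ 4 := by
    simpa using norm_fderiv_three_pertBand_le hδs hu (κ₃ := 0) (fun k _ => by simp) θ
  have hΔ₁ : ‖fderiv ℝ (fun k : Fin 2 → ℝ => sqDispersion k + (fun p : Fin 2 → ℝ => -K.eval p) k)
        (perturbedFermiRadius (fun p : Fin 2 → ℝ => -K.eval p) ν θ • dir θ) -
      fderiv ℝ (fun k : Fin 2 → ℝ => sqDispersion k + (0 : (Fin 2 → ℝ) → ℝ) k) (bandFermiRadius ν θ • dir θ)‖ ≤
      4 * (A₀ / (B.Dtmin - 2 * A₁)) + 2 * A₁ :=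
    (norm_fderiv_two_roots_sub_le B hδs hδs' hδ hδ' hlo hhi hκ hA₁Dt hu hv hE₀ (κ₂ := 0) (E₁ := 2 * A₁) (fun k _ => by simp)
      (fun k _ => by simpa using norm_fderiv_negEval_le hA₁ k) θ).trans (le_of_eq (by ring))
  have hΔ₂ : ‖fderiv ℝ (fderiv ℝ (fun k : Fin 2 → ℝ => sqDispersion k + (fun p : Fin 2 → ℝ => -K.eval p) k))
        (perturbedFermiRadius (fun p : Fin 2 → ℝ => -K.eval p) ν θ • dir θ) -
      fderiv ℝ (fderiv ℝ (fun k : Fin 2 → ℝ => sqDispersion k + (0 : (Fin 2 → ℝ) → ℝ) k)) (bandFermiRadius ν θ • dir θ)‖ ≤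
      4 * (A₀ / (B.Dtmin - 2 * A₁)) + 4 * A₂ :=
    (norm_fderiv_two_two_roots_sub_le B hδs hδs' hδ hδ' hlo hhi hκ hA₁Dt hu hv hE₀ (κ₃ := 0) (E₂ := 4 * A₂) (fun k _ => by simp)
      (fun k _ => by simpa using norm_fderiv_two_negEval_le hA₂ k) θ).trans (le_of_eq (by ring))
  have hΔ₃ : ‖fderiv ℝ (fderiv ℝ (fderiv ℝ (fun k : Fin 2 → ℝ => sqDispersion k + (fun p : Fin 2 → ℝ => -K.eval p) k)))
        (perturbedFermiRadius (fun p : Fin 2 → ℝ => -K.eval p) ν θ • dir θ) -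
      fderiv ℝ (fderiv ℝ (fderiv ℝ (fun k : Fin 2 → ℝ => sqDispersion k + (0 : (Fin 2 → ℝ) → ℝ) k))) (bandFermiRadius ν θ • dir θ)‖ ≤
      4 * (A₀ / (B.Dtmin - 2 * A₁)) + 8 * A₃ :=
    (norm_fderiv_three_two_roots_sub_le B hδs hδs' hδ hδ' hlo hhi hκ hA₁Dt hu hv hE₀ (κ₄ := 0) (E₃ := 8 * A₃) (fun k _ => by simp)
      (fun k _ => by simpa using norm_fderiv_three_frameShift_le hA₃ k) θ).trans (le_of_eq (by ring))
  have hE₄ : ‖fderiv ℝ (fderiv ℝ (fderiv ℝ (fderiv ℝ (fun k : Fin 2 → ℝ => sqDispersion k + (0 : (Fin 2 → ℝ) → ℝ) k))))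
      (bandFermiRadius ν θ • dir θ)‖ ≤ 4 := by
    simpa using norm_fderiv_four_pertBand_le hδs hu (κ₄ := 0) (fun k _ => by simp) θ
  have hΔ₄ : ‖fderiv ℝ (fderiv ℝ (fderiv ℝ (fderiv ℝ (fun k : Fin 2 → ℝ => sqDispersion k + (fun p : Fin 2 → ℝ => -K.eval p) k))))
        (perturbedFermiRadius (fun p : Fin 2 → ℝ => -K.eval p) ν θ • dir θ) -
      fderiv ℝ (fderiv ℝ (fderiv ℝ (fderiv ℝ (fun k : Fin 2 → ℝ => sqDispersion k + (0 : (Fin 2 → ℝ) → ℝ) k))))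
        (bandFermiRadius ν θ • dir θ)‖ ≤ 4 * (A₀ / (B.Dtmin - 2 * A₁)) + 16 * A₄ :=
    (norm_fderiv_four_two_roots_sub_le B hδs hδs' hδ hδ' hlo hhi hκ hA₁Dt hu hv hE₀ (κ₄ := 0) (E₄ := 16 * A₄) (fun k _ => by simp)
      (fun k _ => by simpa using norm_fderiv_four_frameShift_le hA₄ k) θ).trans (le_of_eq (by ring))
  have hR₃f : |deriv (deriv (deriv (bandFermiRadius ν))) θ| ≤ R₃ + W₃ := hR₃.trans (le_add_of_nonneg_right ((abs_nonneg _).trans hW₃))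
  have hR₃v := abs_le_add_of_abs_sub_le hR₃ hW₃
  exact abs_deriv_four_sub_le_of_polar_levels he he'
    (contDiff_four_of_isRoot B hδs hδ hlo hhi hκ hA₁Dt hu) (contDiff_four_of_isRoot B hδs' hδ' hlo hhi hκ' hA₁Dt hv)
    hlev hlev' hρ0 (Dtmin_sub_le_fderiv_pertBand_dir B hδ' hlo hhi hκ' hv hδs' θ) hE₁ hE₂ hE₃ hE₄ hΔ₁ hΔ₂ hΔ₃ hΔ₄
    hUf' hUv hR₁f hR₁v hR₂f hR₂v hR₃f hR₃v hR₄ hW₀ hW₁ hW₂ hW₃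

include B hA₀ hA₁ hA₂ hA₃ hA₄ hA₁Dt hlo hhi in
/-- **The window package to order 4 with the SHARP widths** (`frame_polar_tower_of_window_sharp` + orders 3, 4): free window numbers
`U₀, R₁ … R₄` on `[a, b]`, numbers `W₁ … W₄` dominating the sharp closed forms ⟹ at every angle the five differences and
`u_K ≤ U₀ + W₀`, `|u_K^{(k)}| ≤ R_k + W_k`, `k = 1 … 4`. [cite: BenfattoGiulianiMastropietro2006, §2.4 Lemma 2.1 (2.40)] -/
theorem frame_polar_tower_of_window_sharp34 {U₀ R₁ R₂ R₃ R₄ W₁ W₂ W₃ W₄ : ℝ}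
    (hU₀ : ∀ μ ∈ Icc a b, ∀ θ : ℝ, bandFermiRadius μ θ ≤ U₀)
    (hR₁ : ∀ μ ∈ Icc a b, ∀ θ : ℝ, |deriv (bandFermiRadius μ) θ| ≤ R₁)
    (hR₂ : ∀ μ ∈ Icc a b, ∀ θ : ℝ, |deriv (deriv (bandFermiRadius μ)) θ| ≤ R₂)
    (hR₃ : ∀ μ ∈ Icc a b, ∀ θ : ℝ, |deriv (deriv (deriv (bandFermiRadius μ))) θ| ≤ R₃)
    (hR₄ : ∀ μ ∈ Icc a b, ∀ θ : ℝ, |deriv (deriv (deriv (deriv (bandFermiRadius μ)))) θ| ≤ R₄)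
    (hW₁ : ((4 + 2 * A₁) * (A₀ / (B.Dtmin - 2 * A₁)) + (U₀ + R₁) * (4 * (A₀ / (B.Dtmin - 2 * A₁)) + 2 * A₁)) / (B.Dtmin - 2 * A₁) ≤ W₁)
    (hW₂ : A₀ / (B.Dtmin - 2 * A₁) +
        ((4 * (A₀ / (B.Dtmin - 2 * A₁)) + 4 * A₂) * ((R₁ + W₁) + (U₀ + A₀ / (B.Dtmin - 2 * A₁))) ^ 2 +
          2 * 4 * ((R₁ + W₁) + (U₀ + A₀ / (B.Dtmin - 2 * A₁))) * (W₁ + A₀ / (B.Dtmin - 2 * A₁)) +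
          (4 * (A₀ / (B.Dtmin - 2 * A₁)) + 2 * A₁) * (2 * (R₁ + W₁) + (U₀ + A₀ / (B.Dtmin - 2 * A₁))) +
          4 * (A₀ / (B.Dtmin - 2 * A₁) + 2 * W₁) +
          (R₂ + (U₀ + A₀ / (B.Dtmin - 2 * A₁))) * (4 * (A₀ / (B.Dtmin - 2 * A₁)) + 2 * A₁)) / (B.Dtmin - 2 * A₁) ≤ W₂)
    (hW₃ : ((4 * (A₀ / (B.Dtmin - 2 * A₁)) + 8 * A₃) * ((R₁ + W₁) + (U₀ + (A₀ / (B.Dtmin - 2 * A₁)))) ^ 3 + 3 * 4 * (W₁ + (A₀ / (B.Dtmin - 2 * A₁))) * ((R₁ + W₁) + (U₀ + (A₀ / (B.Dtmin - 2 * A₁)))) ^ 2 +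
        3 * ((4 * (A₀ / (B.Dtmin - 2 * A₁)) + 4 * A₂) * ((R₁ + W₁) + (U₀ + (A₀ / (B.Dtmin - 2 * A₁)))) * ((R₂ + W₂) + 2 * (R₁ + W₁) + (U₀ + (A₀ / (B.Dtmin - 2 * A₁)))) + 4 * ((W₂ + 2 * W₁ + (A₀ / (B.Dtmin - 2 * A₁))) * ((R₁ + W₁) + (U₀ + (A₀ / (B.Dtmin - 2 * A₁)))) + ((R₂ + W₂) + 2 * (R₁ + W₁) + (U₀ + (A₀ / (B.Dtmin - 2 * A₁)))) * (W₁ + (A₀ / (B.Dtmin - 2 * A₁))))) +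
        (4 * (A₀ / (B.Dtmin - 2 * A₁)) + 2 * A₁) * (3 * (R₂ + W₂) + 3 * (R₁ + W₁) + (U₀ + (A₀ / (B.Dtmin - 2 * A₁)))) + 4 * (3 * W₂ + 3 * W₁ + (A₀ / (B.Dtmin - 2 * A₁))) + R₃ * (4 * (A₀ / (B.Dtmin - 2 * A₁)) + 2 * A₁)) / (B.Dtmin - 2 * A₁) ≤ W₃)
    (hW₄ : ((4 * (A₀ / (B.Dtmin - 2 * A₁)) + 16 * A₄) * ((R₁ + W₁) + (U₀ + (A₀ / (B.Dtmin - 2 * A₁)))) ^ 4 + 4 * 4 * (W₁ + (A₀ / (B.Dtmin - 2 * A₁))) * ((R₁ + W₁) + (U₀ + (A₀ / (B.Dtmin - 2 * A₁)))) ^ 3 +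
        6 * ((4 * (A₀ / (B.Dtmin - 2 * A₁)) + 8 * A₃) * ((R₁ + W₁) + (U₀ + (A₀ / (B.Dtmin - 2 * A₁)))) ^ 2 * ((R₂ + W₂) + 2 * (R₁ + W₁) + (U₀ + (A₀ / (B.Dtmin - 2 * A₁)))) +
          4 * ((W₂ + 2 * W₁ + (A₀ / (B.Dtmin - 2 * A₁))) * ((R₁ + W₁) + (U₀ + (A₀ / (B.Dtmin - 2 * A₁)))) ^ 2 + 2 * ((R₁ + W₁) + (U₀ + (A₀ / (B.Dtmin - 2 * A₁)))) * ((R₂ + W₂) + 2 * (R₁ + W₁) + (U₀ + (A₀ / (B.Dtmin - 2 * A₁)))) * (W₁ + (A₀ / (B.Dtmin - 2 * A₁))))) +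
        3 * ((4 * (A₀ / (B.Dtmin - 2 * A₁)) + 4 * A₂) * ((R₂ + W₂) + 2 * (R₁ + W₁) + (U₀ + (A₀ / (B.Dtmin - 2 * A₁)))) ^ 2 + 2 * 4 * ((R₂ + W₂) + 2 * (R₁ + W₁) + (U₀ + (A₀ / (B.Dtmin - 2 * A₁)))) * (W₂ + 2 * W₁ + (A₀ / (B.Dtmin - 2 * A₁)))) +
        4 * ((4 * (A₀ / (B.Dtmin - 2 * A₁)) + 4 * A₂) * ((R₁ + W₁) + (U₀ + (A₀ / (B.Dtmin - 2 * A₁)))) * ((R₃ + W₃) + 3 * (R₁ + W₁) + 3 * (R₂ + W₂) + (U₀ + (A₀ / (B.Dtmin - 2 * A₁)))) +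
          4 * ((W₁ + (A₀ / (B.Dtmin - 2 * A₁))) * ((R₃ + W₃) + 3 * (R₁ + W₁) + 3 * (R₂ + W₂) + (U₀ + (A₀ / (B.Dtmin - 2 * A₁)))) + ((R₁ + W₁) + (U₀ + (A₀ / (B.Dtmin - 2 * A₁)))) * (W₃ + 3 * W₁ + 3 * W₂ + (A₀ / (B.Dtmin - 2 * A₁))))) +
        (4 * (A₀ / (B.Dtmin - 2 * A₁)) + 2 * A₁) * (6 * (R₂ + W₂) + 4 * (R₃ + W₃) + 4 * (R₁ + W₁) + (U₀ + (A₀ / (B.Dtmin - 2 * A₁)))) + 4 * (6 * W₂ + 4 * W₃ + 4 * W₁ + (A₀ / (B.Dtmin - 2 * A₁))) + R₄ * (4 * (A₀ / (B.Dtmin - 2 * A₁)) + 2 * A₁)) / (B.Dtmin - 2 * A₁) ≤ W₄)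
    (θ : ℝ) :
    |perturbedFermiRadius (fun p : Fin 2 → ℝ => -K.eval p) ν θ - bandFermiRadius ν θ| ≤ A₀ / (B.Dtmin - 2 * A₁) ∧
    |deriv (perturbedFermiRadius (fun p : Fin 2 → ℝ => -K.eval p) ν) θ - deriv (bandFermiRadius ν) θ| ≤ W₁ ∧
    |deriv (deriv (perturbedFermiRadius (fun p : Fin 2 → ℝ => -K.eval p) ν)) θ - deriv (deriv (bandFermiRadius ν)) θ| ≤ W₂ ∧
    |deriv (deriv (deriv (perturbedFermiRadius (fun p : Fin 2 → ℝ => -K.eval p) ν))) θ -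
        deriv (deriv (deriv (bandFermiRadius ν))) θ| ≤ W₃ ∧
    |deriv (deriv (deriv (deriv (perturbedFermiRadius (fun p : Fin 2 → ℝ => -K.eval p) ν)))) θ -
        deriv (deriv (deriv (deriv (bandFermiRadius ν)))) θ| ≤ W₄ ∧
    perturbedFermiRadius (fun p : Fin 2 → ℝ => -K.eval p) ν θ ≤ U₀ + A₀ / (B.Dtmin - 2 * A₁) ∧
    |deriv (perturbedFermiRadius (fun p : Fin 2 → ℝ => -K.eval p) ν) θ| ≤ R₁ + W₁ ∧
    |deriv (deriv (perturbedFermiRadius (fun p : Fin 2 → ℝ => -K.eval p) ν)) θ| ≤ R₂ + W₂ ∧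
    |deriv (deriv (deriv (perturbedFermiRadius (fun p : Fin 2 → ℝ => -K.eval p) ν))) θ| ≤ R₃ + W₃ ∧
    |deriv (deriv (deriv (deriv (perturbedFermiRadius (fun p : Fin 2 → ℝ => -K.eval p) ν)))) θ| ≤ R₄ + W₄ := by
  have hν : ν ∈ Icc a b := ⟨by linarith [le_trans (norm_nonneg _) (hA₀ 0)], by linarith [le_trans (norm_nonneg _) (hA₀ 0)]⟩
  obtain ⟨d0, d1, d2, r0, r1, r2⟩ := frame_polar_tower_of_window_sharp B hA₀ hA₁ hA₂ hA₁Dt hlo hhi hU₀ hR₁ hR₂ hW₁ hW₂ θ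
  have u0 := hU₀ ν hν θ
  have f1 := hR₁ ν hν θ
  have f2 := hR₂ ν hν θ
  have f3 := hR₃ ν hν θ
  have f4 := hR₄ ν hν θ
  have d3 := (abs_deriv_three_frameRadius_sub_le_sharp B hA₀ hA₁ hA₂ hA₃ hA₁Dt hlo hhi u0 f1 f2 f3 d1 d2).trans hW₃
  have r3 := abs_le_add_of_abs_sub_le f3 d3
  have d4 := (abs_deriv_four_frameRadius_sub_le_sharp B hA₀ hA₁ hA₂ hA₃ hA₄ hA₁Dt hlo hhi u0 f1 f2 f3 f4 d1 d2 d3).trans hW₄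
  have r4 := abs_le_add_of_abs_sub_le f4 d4
  exact ⟨d0, d1, d2, d3, d4, r0, r1, r2, r3, r4⟩

end Frame

end Summit.HubbardSuperconductivity.HubbardSuperconductivity.Theorems.PerturbedFermiCurve

end
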